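import Mathlib
import HarnessLib
import Summits.ValiantsHypothesis.ValiantsHypothesis.Theorems.LacunarySymmetroidMatrixDescartesProductPlusOneTameSector
import Summits.ValiantsHypothesis.ValiantsHypothesis.Theorems.LacunarySymmetroidMatrixDescartesProductPlusOneSharpSector
import Summits.ValiantsHypothesis.ValiantsHypothesis.Theorems.LacunarySymmetroidMatrixDescartesProductPlusOneMixedSector

/-!
# ValiantsHypothesis / LacunarySymmetroid — crux `MatrixDescartes` (stmt-ValiantsHypothesis-18050, V1),
# LINE (A) «product_plus_one», stub S4″ `stub_eulerBoundK3`: the c-FREE EULER BOUND IN THE SECTORS of the `K = 3` row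

The line's c-free Euler numerator (rev 3, `eulerNumerator d a l₀`, unfolded verbatim here) is
`R = Σ_j (Σ_l a_{jl}(d_l − d_{l₀}) X^{d_l}) · ∏_{i≠j} f_i = θ(∏ f_j) − m·d_{l₀}·∏ f_j`.  For `K = 3`, `d 0 < d 1 < d 2`, writing
`f_j = X^{d 0}·g_j`, `g_j = a_{j0} + a_{j1} X^{e+1} + a_{j2} X^{e+k+2}`: `R = X^{m·d 0} · (X·P′ − ν·P)`, `P = ∏ g_j`, `ν = m (d_{l₀} − d_0)`
(`eulerNumerator_eq`).  Off the zeros of `P`, `X P′ − ν P = P·(Φ − ν)` with `Φ = Σ_j θg_j/g_j` (✓ `eval_euler_prod`), so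

* `euler_pos_roots_le` (generic count): if `Φ` takes the value `ν` at most once on every zero-free interval, then
  `Z₊(X P′ − ν P) ≤ Z₊(P) + (Z₊(P) + 1)` (zeros of `P`, plus one per zero-free component — fibre count as in ✓ `tame_sector_pos_roots`,
  with «two R-zeros in one component ⇒ Φ(w₁) = Φ(w₂) = ν» directly, no Rolle);
* `eulerBound_sharp`: SHARP sector (`a_{j0}, a_{j2} > 0`, every factor negative somewhere; any support, ANY coupled letter `l₀`):
  `Z₊(R) ≤ 4m + 1` (✓ `phisum_injective`, ✓ `prod_trinomial_pos_roots_le_two_mul`);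
* `eulerBound_tame`: NO-DIP sector (`a_{j0} a_{j2} < 0`), ratio `d 2 − d 0 ≤ 4 (d 1 − d 0)`, BOTTOM coupling `l₀ = 0` (`ν = 0`, `Φ = X^{e+1}·Ψ`):
  `Z₊(R) ≤ 2m + 2` (✓ `psi_injective`, ✓ `prod_trinomial_pos_roots_le`).

* `eulerBound_mixed`: MIXED sector (every factor no-dip or a sharp dip), ratio `2 (d 1 − d 0) ≤ d 2 − d 0 ≤ 4 (d 1 − d 0)`, bottom coupling:
  `Z₊(R) ≤ 4m + 1` (✓ `psi_injective_mixed`, ✓ `prod_trinomial_pos_roots_le_mixed`).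

(Top couplings follow by p7 g14's reverse chart — not typed here; the middle coupling for no-dip factors is NOT covered —
`Φ = ν ≠ 0` is not a level of the monotone `Ψ`, see `…ProductPlusOneMiddleLaurent`.)  These feed `stub_eulerBoundK3` (`EulerBoundK3`:
`∃ C₀, ∀ m d a l₀, Z₊(eulerNumerator d a l₀) ≤ C₀ m + C₀`) SECTOR BY SECTOR; the stub itself (all sectors, all couplings) stays OPEN.
Honest framing: sector rungs of a research stub; NOT `stub_eulerBoundK3` / `stub_classRowK3` / `stub_polyLaw` / `MatrixDescartes` / B;
`VP ≠ VNP` NOT proved.  No definitions, no named facts; Mathlib + the lane files.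
-/

set_option linter.dupNamespace false

namespace Summit.ValiantsHypothesis.ValiantsHypothesis.Theorems.LacunarySymmetroidMatrixDescartes

namespace ProductPlusOne

open Polynomial Finset
open scoped BigOperators

/-! ### §1 The generic count for `X·P′ − ν·P` -/

/-- **Generic Euler count.** For the normalised trinomial product `P = ∏_j (a_j + b_j X^{e+1} + c_j X^{e+k+2}) ≠ 0`, a real `ν`, and a
bound `Z₊(P) ≤ B`: if `Φ = Σ_j θg_j/g_j` takes the value `ν` at most once on every zero-free interval of `(0,∞)`, then
`Z₊(X·P′ − C ν·P) ≤ B + (B + 1)`. [folklore; fibre count of ✓ `tame_sector_pos_roots`] -/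
theorem euler_pos_roots_le {m : ℕ} (a b c : Fin m → ℝ) (e k : ℕ)
    (hP0 : (∏ j, (C (a j) + C (b j) * X ^ (e + 1) + C (c j) * X ^ (e + k + 2)) : ℝ[X]) ≠ 0) (ν : ℝ) (B : ℕ)
    (hZ : ((∏ j, (C (a j) + C (b j) * X ^ (e + 1) + C (c j) * X ^ (e + k + 2)) : ℝ[X]).roots.toFinset.filter
      (fun t => 0 < t)).card ≤ B)
    (hinj : ∀ w₁ w₂ : ℝ, 0 < w₁ → w₁ < w₂ →
      (∀ t ∈ Set.Icc w₁ w₂, ∀ j, a j + b j * t ^ (e + 1) + c j * t ^ (e + k + 2) ≠ 0) →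
      (∑ j, (((e : ℝ) + 1) * b j * w₁ ^ (e + 1) + ((e : ℝ) + k + 2) * c j * w₁ ^ (e + k + 2))
          / (a j + b j * w₁ ^ (e + 1) + c j * w₁ ^ (e + k + 2))) = ν →
      (∑ j, (((e : ℝ) + 1) * b j * w₂ ^ (e + 1) + ((e : ℝ) + k + 2) * c j * w₂ ^ (e + k + 2))
          / (a j + b j * w₂ ^ (e + 1) + c j * w₂ ^ (e + k + 2))) = ν → False) :
    ((X * derivative (∏ j, (C (a j) + C (b j) * X ^ (e + 1) + C (c j) * X ^ (e + k + 2)))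
        - C ν * ∏ j, (C (a j) + C (b j) * X ^ (e + 1) + C (c j) * X ^ (e + k + 2)) : ℝ[X]).roots.toFinset.filter
      (fun t => 0 < t)).card ≤ B + (B + 1) := by
  classical
  set P : ℝ[X] := ∏ j, (C (a j) + C (b j) * X ^ (e + 1) + C (c j) * X ^ (e + k + 2)) with hPdef
  set E : ℝ[X] := X * derivative P - C ν * P with hEdef
  set Zp := P.roots.toFinset.filter (fun t => 0 < t) with hZp
  set S := E.roots.toFinset.filter (fun t => 0 < t) with hSdef
  by_cases hE0 : E = 0
  · have : S = ∅ := by rw [hSdef, hE0, roots_zero, Multiset.toFinset_zero, Finset.filter_empty]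
    rw [this, Finset.card_empty]; exact Nat.zero_le _
  have hSmem : ∀ z ∈ S, 0 < z ∧ eval z E = 0 := by
    intro z hz
    rw [hSdef, mem_filter, Multiset.mem_toFinset, mem_roots hE0] at hz
    exact ⟨hz.2, hz.1⟩
  -- split `S` into the zeros of `P` and the rest
  set S₁ := S.filter (fun z => eval z P = 0) with hS₁
  set S₂ := S.filter (fun z => eval z P ≠ 0) with hS₂
  have hsplit : S.card = S₁.card + S₂.card := by
    rw [hS₁, hS₂]; exact (Finset.card_filter_add_card_filter_not _).symm
  have hS₁le : S₁.card ≤ B := by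
    refine le_trans (card_le_card fun z hz => ?_) hZ
    rw [hS₁, mem_filter] at hz
    rw [mem_filter, Multiset.mem_toFinset, mem_roots hP0]
    exact ⟨hz.2, (hSmem z hz.1).1⟩
  -- off the zeros of `P`, a zero of `E` is a point where `Φ = ν`
  have hΦ : ∀ w ∈ S₂, (∀ j, a j + b j * w ^ (e + 1) + c j * w ^ (e + k + 2) ≠ 0) ∧
      (∑ j, (((e : ℝ) + 1) * b j * w ^ (e + 1) + ((e : ℝ) + k + 2) * c j * w ^ (e + k + 2))
          / (a j + b j * w ^ (e + 1) + c j * w ^ (e + k + 2))) = ν := by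
    intro w hw
    rw [hS₂, mem_filter] at hw
    obtain ⟨hwS, hPw⟩ := hw
    have hg : ∀ j, a j + b j * w ^ (e + 1) + c j * w ^ (e + k + 2) ≠ 0 := by
      intro j hj
      apply hPw
      rw [hPdef, eval_prod_trinomial, Finset.prod_eq_zero_iff]
      exact ⟨j, mem_univ _, hj⟩
    refine ⟨hg, ?_⟩
    have hEw := (hSmem w hwS).2
    rw [hEdef, eval_sub, eval_mul, eval_X, eval_mul, eval_C, hPdef, eval_euler_prod a b c e k hg, eval_prod_trinomial] at hEw
    rw [hPdef, eval_prod_trinomial] at hPw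
    -- `P(w)·Φ(w) − ν·P(w) = 0`, `P(w) ≠ 0`
    have := sub_eq_zero.1 hEw
    rw [mul_comm ν] at this
    exact mul_left_cancel₀ hPw this
  -- zero-free intervals: two points of `S₂` with the same number of zeros of `P` below them
  have hfree : ∀ z₁ ∈ S₂, ∀ z₃ ∈ S₂, z₁ < z₃ →
      (Zp.filter (fun t => t < z₁)).card = (Zp.filter (fun t => t < z₃)).card →
      ∀ t ∈ Set.Icc z₁ z₃, ∀ j, a j + b j * t ^ (e + 1) + c j * t ^ (e + k + 2) ≠ 0 := by
    intro z₁ hz₁ z₃ hz₃ h13 hk13 t ht j hj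
    have hz₁0 : 0 < z₁ := by
      have h := hz₁; rw [hS₂, mem_filter] at h; exact (hSmem z₁ h.1).1
    have ht0 : 0 < t := hz₁0.trans_le ht.1
    have hPt : eval t P = 0 := by
      rw [hPdef, eval_prod_trinomial, Finset.prod_eq_zero_iff]
      exact ⟨j, mem_univ _, hj⟩
    rcases eq_or_lt_of_le ht.2 with h | h
    · exact (hΦ z₃ hz₃).1 j (h ▸ hj)
    · have htZ : t ∈ Zp := by
        rw [hZp, mem_filter, Multiset.mem_toFinset, mem_roots hP0]
        exact ⟨hPt, ht0⟩
      have hsub : Zp.filter (fun s => s < z₁) ⊆ Zp.filter (fun s => s < z₃) := by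
        intro s hs
        rw [mem_filter] at hs ⊢
        exact ⟨hs.1, hs.2.trans h13⟩
      have hstrict : Zp.filter (fun s => s < z₁) ⊂ Zp.filter (fun s => s < z₃) := by
        refine Finset.ssubset_iff_subset_ne.mpr ⟨hsub, fun heq => ?_⟩
        have ht1 : t ∈ Zp.filter (fun s => s < z₁) := by
          rw [heq, mem_filter]
          exact ⟨htZ, h⟩
        rw [mem_filter] at ht1
        exact absurd ht1.2 (not_lt.mpr ht.1)
      exact absurd hk13 (Finset.card_lt_card hstrict).ne
  -- every fibre of `z ↦ #{zeros of P below z}` on `S₂` has at most one element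
  have hfiber : ∀ v ∈ S₂.image (fun z => (Zp.filter (fun t => t < z)).card),
      (S₂.filter (fun z => (Zp.filter (fun t => t < z)).card = v)).card ≤ 1 := by
    intro v _
    rw [Finset.card_le_one]
    intro z₁ hz₁ z₂ hz₂
    rw [mem_filter] at hz₁ hz₂
    by_contra hne
    rcases lt_or_gt_of_ne hne with h12 | h21
    · have hz₁0 : 0 < z₁ := by
        have h := hz₁.1; rw [hS₂, mem_filter] at h; exact (hSmem z₁ h.1).1
      exact hinj z₁ z₂ hz₁0 h12 (hfree z₁ hz₁.1 z₂ hz₂.1 h12 (hz₁.2.trans hz₂.2.symm)) (hΦ z₁ hz₁.1).2 (hΦ z₂ hz₂.1).2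
    · have hz₂0 : 0 < z₂ := by
        have h := hz₂.1; rw [hS₂, mem_filter] at h; exact (hSmem z₂ h.1).1
      exact hinj z₂ z₁ hz₂0 h21 (hfree z₂ hz₂.1 z₁ hz₁.1 h21 (hz₂.2.trans hz₁.2.symm)) (hΦ z₂ hz₂.1).2 (hΦ z₁ hz₁.1).2
  have himg : S₂.image (fun z => (Zp.filter (fun t => t < z)).card) ⊆ Finset.range (B + 1) := by
    intro v hv
    rw [Finset.mem_image] at hv
    obtain ⟨z, _, rfl⟩ := hv
    rw [Finset.mem_range]
    exact Nat.lt_succ_of_le ((Finset.card_filter_le _ _).trans hZ)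
  have hS₂le : S₂.card ≤ B + 1 :=
    calc S₂.card = ∑ v ∈ S₂.image (fun z => (Zp.filter (fun t => t < z)).card),
          (S₂.filter (fun z => (Zp.filter (fun t => t < z)).card = v)).card :=
          Finset.card_eq_sum_card_image _ S₂
      _ ≤ ∑ _v ∈ S₂.image (fun z => (Zp.filter (fun t => t < z)).card), 1 := Finset.sum_le_sum hfiber
      _ = (S₂.image (fun z => (Zp.filter (fun t => t < z)).card)).card := by
          rw [Finset.sum_const, smul_eq_mul, mul_one]
      _ ≤ B + 1 := (Finset.card_le_card himg).trans (by rw [Finset.card_range])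
  rw [hsplit]
  exact Nat.add_le_add hS₁le hS₂le

/-! ### §2 The line's Euler numerator in the normalised chart -/

/-- The Euler letter of one trinomial: `Σ_l a_l (d_l − d_{l₀}) X^{d_l} = X^{d 0}·(X·g′ − (d_{l₀} − d_0)·g)`, `g = a0 + a1 X^{e+1} + a2 X^{e+k+2}`.
[folklore] -/
theorem euler_letter_eq (d : Fin 3 → ℕ) (e k : ℕ) (he : d 1 = d 0 + e + 1) (hk : d 2 = d 0 + e + k + 2) (l₀ : Fin 3)
    (a : Fin 3 → ℝ) :
    (∑ l, C (a l * ((d l : ℝ) - d l₀)) * X ^ (d l) : ℝ[X])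
      = X ^ (d 0) * (X * derivative (C (a 0) + C (a 1) * X ^ (e + 1) + C (a 2) * X ^ (e + k + 2))
          - C ((d l₀ : ℝ) - d 0) * (C (a 0) + C (a 1) * X ^ (e + 1) + C (a 2) * X ^ (e + k + 2))) := by
  simp only [Fin.sum_univ_three, derivative_add, derivative_C, derivative_mul, derivative_X_pow, zero_add, zero_mul,
    map_mul, map_sub, he, hk, Nat.add_sub_cancel, show e + k + 2 - 1 = e + k + 1 by omega]
  push_cast
  simp only [map_add, map_natCast, map_one, map_ofNat]
  ring

/-- **The line's c-free Euler numerator in the normalised chart** (`K = 3`, any coupled letter):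
`eulerNumerator d a l₀ = X^{m·d 0} · (X·P′ − m (d_{l₀} − d_0)·P)`, `P = ∏_j (a_{j0} + a_{j1} X^{e+1} + a_{j2} X^{e+k+2})`. [folklore] -/
theorem eulerNumerator_eq {m : ℕ} (d : Fin 3 → ℕ) (e k : ℕ) (he : d 1 = d 0 + e + 1) (hk : d 2 = d 0 + e + k + 2)
    (a : Fin m → Fin 3 → ℝ) (l₀ : Fin 3) :
    (∑ j, (∑ l, C (a j l * ((d l : ℝ) - d l₀)) * X ^ (d l)) * ∏ i ∈ Finset.univ.erase j, (∑ l, C (a i l) * X ^ (d l)) : ℝ[X])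
      = X ^ (m * d 0) * (X * derivative (∏ j, (C (a j 0) + C (a j 1) * X ^ (e + 1) + C (a j 2) * X ^ (e + k + 2)))
          - C ((m : ℝ) * ((d l₀ : ℝ) - d 0)) * ∏ j, (C (a j 0) + C (a j 1) * X ^ (e + 1) + C (a j 2) * X ^ (e + k + 2))) := by
  classical
  set g : Fin m → ℝ[X] := fun j => C (a j 0) + C (a j 1) * X ^ (e + 1) + C (a j 2) * X ^ (e + k + 2) with hg
  have hfac : ∀ j, (∑ l, C (a j l) * X ^ (d l) : ℝ[X]) = X ^ (d 0) * g j := by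
    intro j
    rw [hg, Fin.sum_univ_three, he, hk]
    ring
  have hlet : ∀ j, (∑ l, C (a j l * ((d l : ℝ) - d l₀)) * X ^ (d l) : ℝ[X])
      = X ^ (d 0) * (X * derivative (g j) - C ((d l₀ : ℝ) - d 0) * g j) := fun j => euler_letter_eq d e k he hk l₀ (a j)
  -- `∏_{i ≠ j} X^{d 0} g_i`, times one more `X^{d 0}`, is `X^{m d 0} ∏_{i ≠ j} g_i`
  have herase : ∀ j, X ^ (d 0) * ∏ i ∈ Finset.univ.erase j, (X ^ (d 0) * g i) = X ^ (m * d 0) * ∏ i ∈ Finset.univ.erase j, g i := by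
    intro j
    rw [Finset.prod_mul_distrib, Finset.prod_const, Finset.card_erase_of_mem (Finset.mem_univ j), Finset.card_univ,
      Fintype.card_fin, ← mul_assoc, ← pow_succ', ← pow_mul]
    rcases Nat.eq_zero_or_pos m with hm | hm
    · subst hm; exact j.elim0
    · rw [show d 0 * (m - 1 + 1) = m * d 0 by rw [Nat.sub_add_cancel hm, mul_comm]]
  calc (∑ j, (∑ l, C (a j l * ((d l : ℝ) - d l₀)) * X ^ (d l)) * ∏ i ∈ Finset.univ.erase j, (∑ l, C (a i l) * X ^ (d l)) : ℝ[X])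
      = ∑ j, (X * derivative (g j) - C ((d l₀ : ℝ) - d 0) * g j) * (X ^ (m * d 0) * ∏ i ∈ Finset.univ.erase j, g i) := by
        refine Finset.sum_congr rfl fun j _ => ?_
        rw [hlet j, Finset.prod_congr rfl (fun i _ => hfac i), ← herase j]
        ring
    _ = X ^ (m * d 0) * (X * ∑ j, (∏ i ∈ Finset.univ.erase j, g i) * derivative (g j)
          - C ((d l₀ : ℝ) - d 0) * ∑ j, (∏ i ∈ Finset.univ.erase j, g i) * g j) := by
        rw [Finset.mul_sum, Finset.mul_sum, ← Finset.sum_sub_distrib, Finset.mul_sum]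
        refine Finset.sum_congr rfl fun j _ => ?_
        ring
    _ = X ^ (m * d 0) * (X * derivative (∏ j, g j) - C ((m : ℝ) * ((d l₀ : ℝ) - d 0)) * ∏ j, g j) := by
        rw [derivative_prod_finset]
        congr 2
        rw [Finset.sum_congr rfl (fun j _ => Finset.prod_erase_mul Finset.univ g (Finset.mem_univ j)), Finset.sum_const,
          Finset.card_univ, Fintype.card_fin, nsmul_eq_mul, map_mul, map_natCast]
        ring

/-! ### §3 The sectors -/

/-- Positive zeros of `X^n · E` are the positive zeros of `E`. [folklore] -/
theorem card_pos_roots_X_pow_mul (n : ℕ) (E : ℝ[X]) :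
    ((X ^ n * E).roots.toFinset.filter (fun t => 0 < t)).card = (E.roots.toFinset.filter (fun t => 0 < t)).card := by
  classical
  by_cases hE : E = 0
  · rw [hE, mul_zero]
  have h0 : (X ^ n * E : ℝ[X]) ≠ 0 := mul_ne_zero (pow_ne_zero _ X_ne_zero) hE
  rw [roots_mul h0, roots_pow, roots_X, Multiset.toFinset_add, Finset.filter_union]
  have hz : (((n • ({0} : Multiset ℝ)).toFinset.filter (fun t => 0 < t)) : Finset ℝ) = ∅ := by
    rw [Finset.filter_eq_empty_iff]
    intro t ht
    rw [Multiset.mem_toFinset] at ht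
    have h00 := Multiset.mem_singleton.mp (Multiset.mem_of_mem_nsmul ht)
    rw [h00]
    exact lt_irrefl 0
  rw [hz, Finset.empty_union]

/-- ★ **THE SHARP SECTOR** (`a_{j0}, a_{j2} > 0`, every factor negative somewhere on `(0,∞)`; ANY support `d 0 < d 1 < d 2`, ANY coupled
letter `l₀`): `Z₊(eulerNumerator d a l₀) ≤ 4m + 1`. [this file's theorem] -/
theorem eulerBound_sharp {m : ℕ} (d : Fin 3 → ℕ) (h01 : d 0 < d 1) (h12 : d 1 < d 2) (l₀ : Fin 3)
    (a : Fin m → Fin 3 → ℝ) (hpos : ∀ j, 0 < a j 0 ∧ 0 < a j 2)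
    (hwit : ∀ j, ∃ x₀ : ℝ, 0 < x₀ ∧ a j 0 * x₀ ^ (d 0) + a j 1 * x₀ ^ (d 1) + a j 2 * x₀ ^ (d 2) < 0) :
    ((∑ j, (∑ l, C (a j l * ((d l : ℝ) - d l₀)) * X ^ (d l)) * ∏ i ∈ Finset.univ.erase j, (∑ l, C (a i l) * X ^ (d l))
      : ℝ[X]).roots.toFinset.filter (fun t => 0 < t)).card ≤ 4 * m + 1 := by
  classical
  rcases Nat.eq_zero_or_pos m with hm | hm
  · subst hm
    simp only [Finset.univ_eq_empty, Finset.sum_empty, roots_zero, Multiset.toFinset_zero, Finset.filter_empty,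
      Finset.card_empty]
    exact Nat.zero_le _
  obtain ⟨e, he⟩ : ∃ e, d 1 = d 0 + e + 1 := ⟨d 1 - d 0 - 1, by omega⟩
  obtain ⟨k, hk⟩ : ∃ k, d 2 = d 0 + e + k + 2 := ⟨d 2 - d 1 - 1, by omega⟩
  rw [eulerNumerator_eq d e k he hk a l₀, card_pos_roots_X_pow_mul]
  have hwit' : ∀ j, ∃ x₀ : ℝ, 0 < x₀ ∧ a j 0 + a j 1 * x₀ ^ (e + 1) + a j 2 * x₀ ^ (e + k + 2) < 0 := by
    intro j
    obtain ⟨x₀, hx₀, hneg⟩ := hwit j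
    refine ⟨x₀, hx₀, ?_⟩
    have hxd : 0 < x₀ ^ (d 0) := pow_pos hx₀ _
    have e1 : a j 0 * x₀ ^ (d 0) + a j 1 * x₀ ^ (d 1) + a j 2 * x₀ ^ (d 2)
        = x₀ ^ (d 0) * (a j 0 + a j 1 * x₀ ^ (e + 1) + a j 2 * x₀ ^ (e + k + 2)) := by
      rw [he, hk]; ring
    rw [e1] at hneg
    by_contra hcon
    push Not at hcon
    exact absurd hneg (not_lt.mpr (mul_nonneg hxd.le hcon))
  have hP0 := prod_trinomial_ne_zero_of_pos (fun j => a j 0) (fun j => a j 1) (fun j => a j 2) e k hpos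
  have hZ := prod_trinomial_pos_roots_le_two_mul (fun j => a j 0) (fun j => a j 1) (fun j => a j 2) e k hpos
  have h := euler_pos_roots_le (fun j => a j 0) (fun j => a j 1) (fun j => a j 2) e k hP0
    ((m : ℝ) * ((d l₀ : ℝ) - d 0)) (2 * m) hZ (fun w₁ w₂ hw₁ hw hfree h1 h2 =>
      phisum_injective hm (fun j => a j 0) (fun j => a j 1) (fun j => a j 2) e k hpos hwit' hw₁ hw hfree (h1.trans h2.symm))
  exact h.trans (by omega)

/-- ★ **THE TAME (NO-DIP) SECTOR AT THE BOTTOM COUPLING** (`a_{j0}·a_{j2} < 0`, ratio `d 2 − d 0 ≤ 4 (d 1 − d 0)`, `l₀ = 0`):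
`Z₊(eulerNumerator d a 0) ≤ 2m + 2`. [this file's theorem] -/
theorem eulerBound_tame {m : ℕ} (d : Fin 3 → ℕ) (h01 : d 0 < d 1) (h12 : d 1 < d 2) (h4 : d 2 - d 0 ≤ 4 * (d 1 - d 0))
    (a : Fin m → Fin 3 → ℝ) (hac : ∀ j, a j 0 * a j 2 < 0) :
    ((∑ j, (∑ l, C (a j l * ((d l : ℝ) - d 0)) * X ^ (d l)) * ∏ i ∈ Finset.univ.erase j, (∑ l, C (a i l) * X ^ (d l))
      : ℝ[X]).roots.toFinset.filter (fun t => 0 < t)).card ≤ 2 * m + 2 := by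
  classical
  rcases Nat.eq_zero_or_pos m with hm | hm
  · subst hm
    simp only [Finset.univ_eq_empty, Finset.sum_empty, roots_zero, Multiset.toFinset_zero, Finset.filter_empty,
      Finset.card_empty]
    exact Nat.zero_le _
  obtain ⟨e, he⟩ : ∃ e, d 1 = d 0 + e + 1 := ⟨d 1 - d 0 - 1, by omega⟩
  obtain ⟨k, hk⟩ : ∃ k, d 2 = d 0 + e + k + 2 := ⟨d 2 - d 1 - 1, by omega⟩
  have hk3 : k ≤ 3 * e + 2 := by omega
  rw [eulerNumerator_eq d e k he hk a 0, card_pos_roots_X_pow_mul, sub_self, mul_zero]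
  have hP0 := prod_trinomial_ne_zero (fun j => a j 0) (fun j => a j 1) (fun j => a j 2) e k hac
  have hZ := prod_trinomial_pos_roots_le (fun j => a j 0) (fun j => a j 1) (fun j => a j 2) e k hac
  have h := euler_pos_roots_le (fun j => a j 0) (fun j => a j 1) (fun j => a j 2) e k hP0 0 m hZ ?_
  · exact h.trans (by omega)
  · -- `Φ(w) = w^{e+1}·Ψ(w)`: a zero of `Φ` at `w > 0` is a zero of `Ψ`, and `Ψ` is injective on zero-free intervals
    intro w₁ w₂ hw₁ hw hfree h1 h2
    have hΨ : ∀ w : ℝ, 0 < w →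
        (∑ j, (((e : ℝ) + 1) * a j 1 * w ^ (e + 1) + ((e : ℝ) + k + 2) * a j 2 * w ^ (e + k + 2))
            / (a j 0 + a j 1 * w ^ (e + 1) + a j 2 * w ^ (e + k + 2))) = 0 →
        (∑ j, ((e + 1 : ℝ) * a j 1 + (e + k + 2 : ℝ) * a j 2 * w ^ (k + 1))
            / (a j 0 + a j 1 * w ^ (e + 1) + a j 2 * w ^ (e + k + 2))) = 0 := by
      intro w hw h
      have hwe : w ^ (e + 1) ≠ 0 := pow_ne_zero _ hw.ne'
      have key : (∑ j, (((e : ℝ) + 1) * a j 1 * w ^ (e + 1) + ((e : ℝ) + k + 2) * a j 2 * w ^ (e + k + 2))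
            / (a j 0 + a j 1 * w ^ (e + 1) + a j 2 * w ^ (e + k + 2)))
          = w ^ (e + 1) * ∑ j, ((e + 1 : ℝ) * a j 1 + (e + k + 2 : ℝ) * a j 2 * w ^ (k + 1))
            / (a j 0 + a j 1 * w ^ (e + 1) + a j 2 * w ^ (e + k + 2)) := by
        rw [Finset.mul_sum]
        refine Finset.sum_congr rfl fun j _ => ?_
        rw [mul_div_assoc']
        congr 1
        ring
      rw [key] at h
      exact (mul_eq_zero.1 h).resolve_left hwe
    exact psi_injective hm (fun j => a j 0) (fun j => a j 1) (fun j => a j 2) e k hk3 hac hw₁ hw hfree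
      ((hΨ w₁ hw₁ h1).trans (hΨ w₂ (hw₁.trans hw) h2).symm)

/-- ★ **THE MIXED SECTOR AT THE BOTTOM COUPLING** (every factor no-dip `a_{j0} a_{j2} < 0` or a sharp dip `a_{j0}, a_{j2} > 0` negative somewhere;
ratio `2 (d 1 − d 0) ≤ d 2 − d 0 ≤ 4 (d 1 − d 0)`, `l₀ = 0`): `Z₊(eulerNumerator d a 0) ≤ 4m + 1`. [this file's theorem] -/
theorem eulerBound_mixed {m : ℕ} (d : Fin 3 → ℕ) (h01 : d 0 < d 1) (h12 : d 1 < d 2)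
    (h2 : 2 * (d 1 - d 0) ≤ d 2 - d 0) (h4 : d 2 - d 0 ≤ 4 * (d 1 - d 0)) (a : Fin m → Fin 3 → ℝ)
    (hfac : ∀ j, a j 0 * a j 2 < 0 ∨
      (0 < a j 0 ∧ 0 < a j 2 ∧ ∃ x₀ : ℝ, 0 < x₀ ∧ a j 0 * x₀ ^ (d 0) + a j 1 * x₀ ^ (d 1) + a j 2 * x₀ ^ (d 2) < 0)) :
    ((∑ j, (∑ l, C (a j l * ((d l : ℝ) - d 0)) * X ^ (d l)) * ∏ i ∈ Finset.univ.erase j, (∑ l, C (a i l) * X ^ (d l))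
      : ℝ[X]).roots.toFinset.filter (fun t => 0 < t)).card ≤ 4 * m + 1 := by
  classical
  rcases Nat.eq_zero_or_pos m with hm | hm
  · subst hm
    simp only [Finset.univ_eq_empty, Finset.sum_empty, roots_zero, Multiset.toFinset_zero, Finset.filter_empty,
      Finset.card_empty]
    exact Nat.zero_le _
  obtain ⟨e, he⟩ : ∃ e, d 1 = d 0 + e + 1 := ⟨d 1 - d 0 - 1, by omega⟩
  obtain ⟨k, hk⟩ : ∃ k, d 2 = d 0 + e + k + 2 := ⟨d 2 - d 1 - 1, by omega⟩
  have hke : e ≤ k := by omega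
  have hk3 : k ≤ 3 * e + 2 := by omega
  have hfac' : ∀ j, a j 0 * a j 2 < 0 ∨
      (0 < a j 0 ∧ 0 < a j 2 ∧ ∃ x₀ : ℝ, 0 < x₀ ∧ a j 0 + a j 1 * x₀ ^ (e + 1) + a j 2 * x₀ ^ (e + k + 2) < 0) := by
    intro j
    rcases hfac j with h | ⟨ha, hc, x₀, hx₀, hneg⟩
    · exact Or.inl h
    · refine Or.inr ⟨ha, hc, x₀, hx₀, ?_⟩
      have hxd : 0 < x₀ ^ (d 0) := pow_pos hx₀ _
      have e1 : a j 0 * x₀ ^ (d 0) + a j 1 * x₀ ^ (d 1) + a j 2 * x₀ ^ (d 2)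
          = x₀ ^ (d 0) * (a j 0 + a j 1 * x₀ ^ (e + 1) + a j 2 * x₀ ^ (e + k + 2)) := by
        rw [he, hk]; ring
      rw [e1] at hneg
      by_contra hcon
      push Not at hcon
      exact absurd hneg (not_lt.mpr (mul_nonneg hxd.le hcon))
  rw [eulerNumerator_eq d e k he hk a 0, card_pos_roots_X_pow_mul, sub_self, mul_zero]
  have hP0 := prod_trinomial_ne_zero_mixed (fun j => a j 0) (fun j => a j 1) (fun j => a j 2) e k hfac'
  have hZ := prod_trinomial_pos_roots_le_mixed (fun j => a j 0) (fun j => a j 1) (fun j => a j 2) e k hfac'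
  have h := euler_pos_roots_le (fun j => a j 0) (fun j => a j 1) (fun j => a j 2) e k hP0 0 (2 * m) hZ ?_
  · exact h.trans (by omega)
  · intro w₁ w₂ hw₁ hw hfree h1 h2
    have hΨ : ∀ w : ℝ, 0 < w →
        (∑ j, (((e : ℝ) + 1) * a j 1 * w ^ (e + 1) + ((e : ℝ) + k + 2) * a j 2 * w ^ (e + k + 2))
            / (a j 0 + a j 1 * w ^ (e + 1) + a j 2 * w ^ (e + k + 2))) = 0 →
        (∑ j, ((e + 1 : ℝ) * a j 1 + (e + k + 2 : ℝ) * a j 2 * w ^ (k + 1))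
            / (a j 0 + a j 1 * w ^ (e + 1) + a j 2 * w ^ (e + k + 2))) = 0 := by
      intro w hw h
      have hwe : w ^ (e + 1) ≠ 0 := pow_ne_zero _ hw.ne'
      have key : (∑ j, (((e : ℝ) + 1) * a j 1 * w ^ (e + 1) + ((e : ℝ) + k + 2) * a j 2 * w ^ (e + k + 2))
            / (a j 0 + a j 1 * w ^ (e + 1) + a j 2 * w ^ (e + k + 2)))
          = w ^ (e + 1) * ∑ j, ((e + 1 : ℝ) * a j 1 + (e + k + 2 : ℝ) * a j 2 * w ^ (k + 1))
            / (a j 0 + a j 1 * w ^ (e + 1) + a j 2 * w ^ (e + k + 2)) := by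
        rw [Finset.mul_sum]
        refine Finset.sum_congr rfl fun j _ => ?_
        rw [mul_div_assoc']
        congr 1
        ring
      rw [key] at h
      exact (mul_eq_zero.1 h).resolve_left hwe
    exact psi_injective_mixed hm (fun j => a j 0) (fun j => a j 1) (fun j => a j 2) e k hke hk3 hfac' hw₁ hw hfree
      ((hΨ w₁ hw₁ h1).trans (hΨ w₂ (hw₁.trans hw) h2).symm)

end ProductPlusOne

end Summit.ValiantsHypothesis.ValiantsHypothesis.Theorems.LacunarySymmetroidMatrixDescartes
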